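import Summits.RiemannHypothesis.RiemannHypothesis.Theorems.SemilocalNegCertUptoHundredThirtyNineKinkedI
import Summits.RiemannHypothesis.RiemannHypothesis.Theorems.SemilocalNegCertUptoHundredThirtyNineKinkedJ
import Summits.RiemannHypothesis.RiemannHypothesis.Theorems.SemilocalNegCertUptoHundredThirtyNineKinkedK
import Summits.RiemannHypothesis.RiemannHypothesis.Theorems.SemilocalNegCertUptoHundredThirtyNineKinkedL
import Summits.RiemannHypothesis.RiemannHypothesis.Theorems.SemilocalNegCertUptoHundredThirtyNineKinkedM
import Summits.RiemannHypothesis.RiemannHypothesis.Theorems.SemilocalNegCertUptoHundredThirtyNineKinkedN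
import Summits.RiemannHypothesis.RiemannHypothesis.Theorems.SemilocalNegCertUptoHundredThirtyNineKinkedO
import Summits.RiemannHypothesis.RiemannHypothesis.Theorems.SemilocalNegCertUptoHundredThirtyNineKinkedP
import Summits.RiemannHypothesis.RiemannHypothesis.Theorems.SemilocalNegCertUptoHundredThirtyNineKinkedQ
import HarnessLib

/-!
# Semi-local threshold of the `{∞} ∪ {p < 149}` form, negative side: `a*({2,…,139}) ≤ 321/128` — the wall `q = 149` from a KINKED (piecewise-cubic) witness (part 13/18: the composition of the piece facts 150 … 299)

Cell `rh-explicit` (HOME `run/shared/lean/pub/rh-explicit/`), seat cc-s2-4 (A4 SEMILOCAL-TABLE, kernel column; pipeline gen11 `mkkinked.py`).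
Honest framing: theorems about the tree's `weilSemilocalThreshold S`; nothing here bears on RH.  No data is trusted: every bound is a
`decide +kernel` fact of the piecewise certificate `SemilocalPiecewiseCert.lean` (cc-s2-4 gen8).

Instance: `S = {p < 149}`, window `b = 321/128` (last /1024 value below `(log 151)/2`), `N = 150`, 47 atoms; odd piecewise-cubic
witness with 24 slope breaks at the atom images `|b − log n|` nearest `0` (atoms `n = 13, 11, 16, 9, 17, 8, 19, 7, 23, 25, 27, 29, 5, 31, 32, 37, 4, 41, 43, 47, 49, 3, 53, 59`,
rounded to `/1024`); float finder `Re Q/‖G‖² = -1.416e-04` (no polar credit); orders `(10, 4, 8, 4, 10, 40)`, 605 `t`-pieces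
(far widths ≤ 1/4); exact kernel margin `(rhs − lhs)/‖G‖² = 1.4144e-04`.  ⇒ **`a*({p < 149}) ≤ 321/128 < (log 151)/2`**.
The instance is split for the gate into part 1
(table, certificate, `checkMainPW`, the atom side in kernel chunks of ≤ 4 atoms via `SemilocalPiecewiseCertSplit.lean`), parts 2–10
(68 piece facts each in the FLEX layout of `SemilocalPiecewiseCertFlex.lean` (cc-s2-4 gen12, CC4-LEAN §17.2): piece `0` by `checkPiecePW`,
every far piece by `checkPieceFlex i ⟨n, m, K, m', u₀⟩` with the orders that piece needs (mean majorant degree ≈ 62 instead of 176) and a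
short dyadic centre `u₀ ≤ u_K(T₀)` — same witness, same cuts, claims recomputed (`⌈exact⌉ + 1`), kernel margin `1.4142e-04`·‖G‖²; each
fact file imports part 1 only), the Pieces part (composition) and the Final part (theorems).  Folklore throughout.
-/

set_option autoImplicit false
set_option linter.dupNamespace false  -- the mandated namespace repeats `RiemannHypothesis`
set_option Elab.async false  -- serialise the kernel facts: in parallel they exhaust the node's per-process heap (cc-s2-4 gen11, CC4-LEAN §16.10)

noncomputable section

open Complex Filter Set MeasureTheory Topology
open scoped Real

namespace Summit.RiemannHypothesis.RiemannHypothesis.Theorems.SemilocalPolyWitness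

open MeasureTheory Set Finset Real
open Literature.NumberTheory.LFunctions
open Summit.RiemannHypothesis.RiemannHypothesis.Theorems.MotivicDoor
open Summit.RiemannHypothesis.RiemannHypothesis.Theorems.MotivicDoor.SemilocalThreshold
open Summit.RiemannHypothesis.RiemannHypothesis.Theorems.MotivicDoor.SemilocalMarkov
open LQ

/-- pieces `150 ≤ i < 300` of `certUptoHundredThirtyNineKinked` check (FLEX form). -/
theorem check_UptoHundredThirtyNineKinked_pieces_2 : ∀ i, 150 ≤ i → i < 300 →
    certUptoHundredThirtyNineKinked.checkPiecePW i = true ∨ ∃ o, certUptoHundredThirtyNineKinked.checkPieceFlex i o = true := by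
  intro i hlo hhi
  interval_cases i
  · exact Or.inr ⟨_, check_UptoHundredThirtyNineKinked_piece150⟩
  · exact Or.inr ⟨_, check_UptoHundredThirtyNineKinked_piece151⟩
  · exact Or.inr ⟨_, check_UptoHundredThirtyNineKinked_piece152⟩
  · exact Or.inr ⟨_, check_UptoHundredThirtyNineKinked_piece153⟩
  · exact Or.inr ⟨_, check_UptoHundredThirtyNineKinked_piece154⟩
  · exact Or.inr ⟨_, check_UptoHundredThirtyNineKinked_piece155⟩
  · exact Or.inr ⟨_, check_UptoHundredThirtyNineKinked_piece156⟩
  · exact Or.inr ⟨_, check_UptoHundredThirtyNineKinked_piece157⟩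
  · exact Or.inr ⟨_, check_UptoHundredThirtyNineKinked_piece158⟩
  · exact Or.inr ⟨_, check_UptoHundredThirtyNineKinked_piece159⟩
  · exact Or.inr ⟨_, check_UptoHundredThirtyNineKinked_piece160⟩
  · exact Or.inr ⟨_, check_UptoHundredThirtyNineKinked_piece161⟩
  · exact Or.inr ⟨_, check_UptoHundredThirtyNineKinked_piece162⟩
  · exact Or.inr ⟨_, check_UptoHundredThirtyNineKinked_piece163⟩
  · exact Or.inr ⟨_, check_UptoHundredThirtyNineKinked_piece164⟩
  · exact Or.inr ⟨_, check_UptoHundredThirtyNineKinked_piece165⟩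
  · exact Or.inr ⟨_, check_UptoHundredThirtyNineKinked_piece166⟩
  · exact Or.inr ⟨_, check_UptoHundredThirtyNineKinked_piece167⟩
  · exact Or.inr ⟨_, check_UptoHundredThirtyNineKinked_piece168⟩
  · exact Or.inr ⟨_, check_UptoHundredThirtyNineKinked_piece169⟩
  · exact Or.inr ⟨_, check_UptoHundredThirtyNineKinked_piece170⟩
  · exact Or.inr ⟨_, check_UptoHundredThirtyNineKinked_piece171⟩
  · exact Or.inr ⟨_, check_UptoHundredThirtyNineKinked_piece172⟩
  · exact Or.inr ⟨_, check_UptoHundredThirtyNineKinked_piece173⟩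
  · exact Or.inr ⟨_, check_UptoHundredThirtyNineKinked_piece174⟩
  · exact Or.inr ⟨_, check_UptoHundredThirtyNineKinked_piece175⟩
  · exact Or.inr ⟨_, check_UptoHundredThirtyNineKinked_piece176⟩
  · exact Or.inr ⟨_, check_UptoHundredThirtyNineKinked_piece177⟩
  · exact Or.inr ⟨_, check_UptoHundredThirtyNineKinked_piece178⟩
  · exact Or.inr ⟨_, check_UptoHundredThirtyNineKinked_piece179⟩
  · exact Or.inr ⟨_, check_UptoHundredThirtyNineKinked_piece180⟩
  · exact Or.inr ⟨_, check_UptoHundredThirtyNineKinked_piece181⟩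
  · exact Or.inr ⟨_, check_UptoHundredThirtyNineKinked_piece182⟩
  · exact Or.inr ⟨_, check_UptoHundredThirtyNineKinked_piece183⟩
  · exact Or.inr ⟨_, check_UptoHundredThirtyNineKinked_piece184⟩
  · exact Or.inr ⟨_, check_UptoHundredThirtyNineKinked_piece185⟩
  · exact Or.inr ⟨_, check_UptoHundredThirtyNineKinked_piece186⟩
  · exact Or.inr ⟨_, check_UptoHundredThirtyNineKinked_piece187⟩
  · exact Or.inr ⟨_, check_UptoHundredThirtyNineKinked_piece188⟩
  · exact Or.inr ⟨_, check_UptoHundredThirtyNineKinked_piece189⟩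
  · exact Or.inr ⟨_, check_UptoHundredThirtyNineKinked_piece190⟩
  · exact Or.inr ⟨_, check_UptoHundredThirtyNineKinked_piece191⟩
  · exact Or.inr ⟨_, check_UptoHundredThirtyNineKinked_piece192⟩
  · exact Or.inr ⟨_, check_UptoHundredThirtyNineKinked_piece193⟩
  · exact Or.inr ⟨_, check_UptoHundredThirtyNineKinked_piece194⟩
  · exact Or.inr ⟨_, check_UptoHundredThirtyNineKinked_piece195⟩
  · exact Or.inr ⟨_, check_UptoHundredThirtyNineKinked_piece196⟩
  · exact Or.inr ⟨_, check_UptoHundredThirtyNineKinked_piece197⟩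
  · exact Or.inr ⟨_, check_UptoHundredThirtyNineKinked_piece198⟩
  · exact Or.inr ⟨_, check_UptoHundredThirtyNineKinked_piece199⟩
  · exact Or.inr ⟨_, check_UptoHundredThirtyNineKinked_piece200⟩
  · exact Or.inr ⟨_, check_UptoHundredThirtyNineKinked_piece201⟩
  · exact Or.inr ⟨_, check_UptoHundredThirtyNineKinked_piece202⟩
  · exact Or.inr ⟨_, check_UptoHundredThirtyNineKinked_piece203⟩
  · exact Or.inr ⟨_, check_UptoHundredThirtyNineKinked_piece204⟩
  · exact Or.inr ⟨_, check_UptoHundredThirtyNineKinked_piece205⟩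
  · exact Or.inr ⟨_, check_UptoHundredThirtyNineKinked_piece206⟩
  · exact Or.inr ⟨_, check_UptoHundredThirtyNineKinked_piece207⟩
  · exact Or.inr ⟨_, check_UptoHundredThirtyNineKinked_piece208⟩
  · exact Or.inr ⟨_, check_UptoHundredThirtyNineKinked_piece209⟩
  · exact Or.inr ⟨_, check_UptoHundredThirtyNineKinked_piece210⟩
  · exact Or.inr ⟨_, check_UptoHundredThirtyNineKinked_piece211⟩
  · exact Or.inr ⟨_, check_UptoHundredThirtyNineKinked_piece212⟩
  · exact Or.inr ⟨_, check_UptoHundredThirtyNineKinked_piece213⟩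
  · exact Or.inr ⟨_, check_UptoHundredThirtyNineKinked_piece214⟩
  · exact Or.inr ⟨_, check_UptoHundredThirtyNineKinked_piece215⟩
  · exact Or.inr ⟨_, check_UptoHundredThirtyNineKinked_piece216⟩
  · exact Or.inr ⟨_, check_UptoHundredThirtyNineKinked_piece217⟩
  · exact Or.inr ⟨_, check_UptoHundredThirtyNineKinked_piece218⟩
  · exact Or.inr ⟨_, check_UptoHundredThirtyNineKinked_piece219⟩
  · exact Or.inr ⟨_, check_UptoHundredThirtyNineKinked_piece220⟩
  · exact Or.inr ⟨_, check_UptoHundredThirtyNineKinked_piece221⟩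
  · exact Or.inr ⟨_, check_UptoHundredThirtyNineKinked_piece222⟩
  · exact Or.inr ⟨_, check_UptoHundredThirtyNineKinked_piece223⟩
  · exact Or.inr ⟨_, check_UptoHundredThirtyNineKinked_piece224⟩
  · exact Or.inr ⟨_, check_UptoHundredThirtyNineKinked_piece225⟩
  · exact Or.inr ⟨_, check_UptoHundredThirtyNineKinked_piece226⟩
  · exact Or.inr ⟨_, check_UptoHundredThirtyNineKinked_piece227⟩
  · exact Or.inr ⟨_, check_UptoHundredThirtyNineKinked_piece228⟩
  · exact Or.inr ⟨_, check_UptoHundredThirtyNineKinked_piece229⟩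
  · exact Or.inr ⟨_, check_UptoHundredThirtyNineKinked_piece230⟩
  · exact Or.inr ⟨_, check_UptoHundredThirtyNineKinked_piece231⟩
  · exact Or.inr ⟨_, check_UptoHundredThirtyNineKinked_piece232⟩
  · exact Or.inr ⟨_, check_UptoHundredThirtyNineKinked_piece233⟩
  · exact Or.inr ⟨_, check_UptoHundredThirtyNineKinked_piece234⟩
  · exact Or.inr ⟨_, check_UptoHundredThirtyNineKinked_piece235⟩
  · exact Or.inr ⟨_, check_UptoHundredThirtyNineKinked_piece236⟩
  · exact Or.inr ⟨_, check_UptoHundredThirtyNineKinked_piece237⟩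
  · exact Or.inr ⟨_, check_UptoHundredThirtyNineKinked_piece238⟩
  · exact Or.inr ⟨_, check_UptoHundredThirtyNineKinked_piece239⟩
  · exact Or.inr ⟨_, check_UptoHundredThirtyNineKinked_piece240⟩
  · exact Or.inr ⟨_, check_UptoHundredThirtyNineKinked_piece241⟩
  · exact Or.inr ⟨_, check_UptoHundredThirtyNineKinked_piece242⟩
  · exact Or.inr ⟨_, check_UptoHundredThirtyNineKinked_piece243⟩
  · exact Or.inr ⟨_, check_UptoHundredThirtyNineKinked_piece244⟩
  · exact Or.inr ⟨_, check_UptoHundredThirtyNineKinked_piece245⟩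
  · exact Or.inr ⟨_, check_UptoHundredThirtyNineKinked_piece246⟩
  · exact Or.inr ⟨_, check_UptoHundredThirtyNineKinked_piece247⟩
  · exact Or.inr ⟨_, check_UptoHundredThirtyNineKinked_piece248⟩
  · exact Or.inr ⟨_, check_UptoHundredThirtyNineKinked_piece249⟩
  · exact Or.inr ⟨_, check_UptoHundredThirtyNineKinked_piece250⟩
  · exact Or.inr ⟨_, check_UptoHundredThirtyNineKinked_piece251⟩
  · exact Or.inr ⟨_, check_UptoHundredThirtyNineKinked_piece252⟩
  · exact Or.inr ⟨_, check_UptoHundredThirtyNineKinked_piece253⟩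
  · exact Or.inr ⟨_, check_UptoHundredThirtyNineKinked_piece254⟩
  · exact Or.inr ⟨_, check_UptoHundredThirtyNineKinked_piece255⟩
  · exact Or.inr ⟨_, check_UptoHundredThirtyNineKinked_piece256⟩
  · exact Or.inr ⟨_, check_UptoHundredThirtyNineKinked_piece257⟩
  · exact Or.inr ⟨_, check_UptoHundredThirtyNineKinked_piece258⟩
  · exact Or.inr ⟨_, check_UptoHundredThirtyNineKinked_piece259⟩
  · exact Or.inr ⟨_, check_UptoHundredThirtyNineKinked_piece260⟩
  · exact Or.inr ⟨_, check_UptoHundredThirtyNineKinked_piece261⟩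
  · exact Or.inr ⟨_, check_UptoHundredThirtyNineKinked_piece262⟩
  · exact Or.inr ⟨_, check_UptoHundredThirtyNineKinked_piece263⟩
  · exact Or.inr ⟨_, check_UptoHundredThirtyNineKinked_piece264⟩
  · exact Or.inr ⟨_, check_UptoHundredThirtyNineKinked_piece265⟩
  · exact Or.inr ⟨_, check_UptoHundredThirtyNineKinked_piece266⟩
  · exact Or.inr ⟨_, check_UptoHundredThirtyNineKinked_piece267⟩
  · exact Or.inr ⟨_, check_UptoHundredThirtyNineKinked_piece268⟩
  · exact Or.inr ⟨_, check_UptoHundredThirtyNineKinked_piece269⟩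
  · exact Or.inr ⟨_, check_UptoHundredThirtyNineKinked_piece270⟩
  · exact Or.inr ⟨_, check_UptoHundredThirtyNineKinked_piece271⟩
  · exact Or.inr ⟨_, check_UptoHundredThirtyNineKinked_piece272⟩
  · exact Or.inr ⟨_, check_UptoHundredThirtyNineKinked_piece273⟩
  · exact Or.inr ⟨_, check_UptoHundredThirtyNineKinked_piece274⟩
  · exact Or.inr ⟨_, check_UptoHundredThirtyNineKinked_piece275⟩
  · exact Or.inr ⟨_, check_UptoHundredThirtyNineKinked_piece276⟩
  · exact Or.inr ⟨_, check_UptoHundredThirtyNineKinked_piece277⟩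
  · exact Or.inr ⟨_, check_UptoHundredThirtyNineKinked_piece278⟩
  · exact Or.inr ⟨_, check_UptoHundredThirtyNineKinked_piece279⟩
  · exact Or.inr ⟨_, check_UptoHundredThirtyNineKinked_piece280⟩
  · exact Or.inr ⟨_, check_UptoHundredThirtyNineKinked_piece281⟩
  · exact Or.inr ⟨_, check_UptoHundredThirtyNineKinked_piece282⟩
  · exact Or.inr ⟨_, check_UptoHundredThirtyNineKinked_piece283⟩
  · exact Or.inr ⟨_, check_UptoHundredThirtyNineKinked_piece284⟩
  · exact Or.inr ⟨_, check_UptoHundredThirtyNineKinked_piece285⟩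
  · exact Or.inr ⟨_, check_UptoHundredThirtyNineKinked_piece286⟩
  · exact Or.inr ⟨_, check_UptoHundredThirtyNineKinked_piece287⟩
  · exact Or.inr ⟨_, check_UptoHundredThirtyNineKinked_piece288⟩
  · exact Or.inr ⟨_, check_UptoHundredThirtyNineKinked_piece289⟩
  · exact Or.inr ⟨_, check_UptoHundredThirtyNineKinked_piece290⟩
  · exact Or.inr ⟨_, check_UptoHundredThirtyNineKinked_piece291⟩
  · exact Or.inr ⟨_, check_UptoHundredThirtyNineKinked_piece292⟩
  · exact Or.inr ⟨_, check_UptoHundredThirtyNineKinked_piece293⟩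
  · exact Or.inr ⟨_, check_UptoHundredThirtyNineKinked_piece294⟩
  · exact Or.inr ⟨_, check_UptoHundredThirtyNineKinked_piece295⟩
  · exact Or.inr ⟨_, check_UptoHundredThirtyNineKinked_piece296⟩
  · exact Or.inr ⟨_, check_UptoHundredThirtyNineKinked_piece297⟩
  · exact Or.inr ⟨_, check_UptoHundredThirtyNineKinked_piece298⟩
  · exact Or.inr ⟨_, check_UptoHundredThirtyNineKinked_piece299⟩

end Summit.RiemannHypothesis.RiemannHypothesis.Theorems.SemilocalPolyWitness

end
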